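import Literature.Analysis.FluidPDE.TaoAnnulusAssembly
import Literature.Analysis.FluidPDE.TaoY6WhitneySum
import HarnessLib

/-!
# Tao (2011/2013), Theorem 10.1 in the annular form of Remark 10.6 — the a priori unit-viscosity
# statement is a theorem

This file discharges the named fact
`Literature.Analysis.FluidPDE.tao2011_enstrophyLocalisation_annulus_apriori_unit`
(`TaoEnstrophyLocalisationAnnulus.lean`): Tao 2011, Thm. 10.1 (arXiv Thm. 59) in the annular
geometry of Remark 10.6 (arXiv Rem. 64), a priori form at unit viscosity — given a smooth
finite-energy solution on `[0, T] × ℝ³` with energy `E`, total speed `M`, and initial enstrophy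
`≤ δ²` on the annulus `{R₁ ≤ |x - x₀| ≤ R₂}`, the enstrophy on the shrunken annulus stays `O(δ²)`
and the vorticity gradient is square integrable there, under the smallness
`δ⁴T + δ⁵E^{1/2}T ≤ c` and the largeness `r > C(E + M + δ⁻²)` of the margin.

The proof is the composition of two results of the tree:

* `tao2011_enstrophyLocalisation_annulus_apriori_unit_of_nonlinearEstimate`
  (`TaoAnnulusAssembly.lean`): the whole of Tao's §10 argument in the annulus — the moving Lipschitz
  cutoff, the enstrophy identity `∂ₜW = -Y₁ + Y₂' - Y₃ + … + Y₆`, the linear estimates, the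
  Gronwall/continuity argument and the extraction (10.16)–(10.17) — conditional on the nonlinear
  (vortex-stretching) estimate `tao2011_nonlinearEstimate` for `Y₆`;
* `tao2011_nonlinearEstimate_holds` (`TaoY6WhitneySum.lean`): the nonlinear estimate
  "`|Y₆| ≲ c^{-0.15}δ³W^{3/2} + c^{0.05}δ⁻¹W^{1/2}Y₁ + c^{0.75}W/T + c^{0.9}Y₂`" (arXiv pp. 31–33:
  Whitney decomposition, local Biot–Savart law, local Sobolev inequality, the averages `wᵢ` and the
  parent-ball chain).

## Mathlib / tree search

`lean search tao2011_enstrophyLocalisation_annulus_apriori_unit`: the fact (def), its consumers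
(`TaoEnstrophyLocalisationAnnulus`, `TaoBlowup*`), and the conditional assembly above; no `_holds`.
`tao2011_nonlinearEstimate_holds` landed in `TaoY6WhitneySum` (a second, independent discharge of
the same estimate by a continuous Whitney family is `TaoWhitneyKernel`/`TaoRayChain`/
`TaoWhitneyChain`).

## References

* T. Tao, *Localisation and compactness properties of the Navier–Stokes global regularity
  problem*, Anal. PDE 6 (2013) 25–107 = arXiv:1108.1165 (`Tao2011`): Thm. 10.1 and its proof
  (arXiv Thm. 59, §10, pp. 30–33), Remark 10.6 (arXiv Rem. 64, p. 33).
-/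

namespace Literature.Analysis.FluidPDE

/-- **Tao 2011, Thm. 10.1 (Enstrophy localisation), annular form of Remark 10.6, a priori
statement at unit viscosity — a theorem** (discharge of the named fact
`tao2011_enstrophyLocalisation_annulus_apriori_unit` through the tree's assembly
`tao2011_enstrophyLocalisation_annulus_apriori_unit_of_nonlinearEstimate` and the nonlinear
estimate `tao2011_nonlinearEstimate_holds`). [cite: Tao2011, Thm. 10.1 (arXiv Thm. 59, proof §10 pp. 30–33) + Remark 10.6 (arXiv Rem. 64)] -/
theorem tao2011_enstrophyLocalisation_annulus_apriori_unit_holds :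
    tao2011_enstrophyLocalisation_annulus_apriori_unit :=
  tao2011_enstrophyLocalisation_annulus_apriori_unit_of_nonlinearEstimate tao2011_nonlinearEstimate_holds


end Literature.Analysis.FluidPDE
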